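import Summits.CriticalPhenomena.PercolationContinuityZ3.Theorems.PercNearOneGluingNoHeavyLowerTailKnQuestion8CoefficientwiseStarClass
import Summits.CriticalPhenomena.PercolationContinuityZ3.Theorems.PercNearOneGluingNoHeavyLowerTailKnQuestion8CoefficientwisePendantEdge
import HarnessLib

/-!
# The no-core BOX at the neighbourhood of a point: `Σ_{s : no far end of a D-edge is doubly reached} f̂ĝ ≥ 0` for every set `D` of edges at the point — prim-lf-2 gen 48

Support file (`--supports stmt-CriticalPhenomena-4575`, closed), prover `prim-lf-2` (gen 48).  No definitions, no named facts, no sorries; standard axioms.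
Memo `prim-lf-2/CW-HT-gen48.md` §3c.  Builds on `…KnQuestion8CoefficientwiseStarClass.lean` (inactive star `openCluster_union_star_subset`, `mem_openCluster_iff_of_edge`).

Setting.  Finite multigraph `ends : ι → Sym2 V`, root `x`, `K(s) = openCluster (ends '' s) x`, `f = 1[u ∈ ·]` (a POINT), `g` monotone.  CONJECTURE BOX of prim-lf-2 gen 46 (wall-free face
NO-CORE(D)): for every vertex set `D`, `Σ_{s : D ∩ K s ∩ K sᶜ = ∅} f̂ĝ ≥ 0`.  THIS FILE PROVES IT FOR EVERY `D ⊆ N(u)`: let `D` be any finite set of edges at `u` with far ends `far i`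
(`ends i = s(u, far i)`, `far i ≠ u`); then
  `0 ≤ Σ_{s : ∀ i ∈ D, ¬(far i ∈ K s ∧ far i ∈ K sᶜ)} ([u ∈ K s] − [u ∈ K sᶜ])·(g(K s) − g(K sᶜ))`        (`noCore_nbhd_nonneg`; `|D| = 1` is `noCore_adj_point_nonneg`).
Proof.  Group the colourings by the colours `R ⊆ D` of the `D`-edges (`sum_cube_eq_sum_powerset_subcube`): on the class `R` (red) the clusters are `a(r) = K(r⁺ ∪ R)`, `b(r) = K((rᶜ)⁺ ∪ (D∖R))`
over the sub-cube `r ⊆ ι ∖ D`, and `[far i ∈ a] = [u ∈ a]` for `i ∈ R`, `[far i ∈ b] = [u ∈ b]` for `i ∈ D ∖ R`; so on `{u ∈ a ∖ b}` the event is the monotone `∀ i ∈ R, far i ∉ b`, on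
`{u ∈ b ∖ a}` it is `∀ i ∈ D∖R, far i ∉ a`, and `f̂ = 0` elsewhere.  Folding the second part through `r ↦ rᶜ` and splitting each difference through the swapped cluster gives four brackets
(`noCoreNbhd_class_nonneg`): two antithetic kernels (`AntitheticProduct.sum_mul_sub_compl_nonneg`) and two TERMWISE nonnegative ones — on their supports `u` is not in the relevant blue cluster,
so the star `D∖R` resp. `R` (all edges at `u`) is inactive (`openCluster_union_star_subset`) and the two blue clusters are nested.  Every class being `≥ 0`, so is the sum.
Exact pre-check (prim-lf-2 code/gen48/c/ncD.c): all classes for `D ⊆ N(u)`, `|D| ≤ 3`, all graphs on ≤ 6 vertices: 0 / 415 200 negative.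
[cite: KozmaNitzan2024, Questions 8–9 (§5.5 p. 36) (context: the Question-8 pocket covariance programme)]
-/

namespace Summit.CriticalPhenomena.PercolationContinuityZ3.Theorems

open Finset Literature.Probability.Percolation

namespace Coefficientwise

variable {ι V : Type*} [Fintype ι] [DecidableEq ι] (ends : ι → Sym2 V) (x : V)

open Classical in
/-- **Every colour class of the no-core box at `N(u)` is nonnegative.**  `D` a finite set of edges at `u` with far ends `far`, `R ⊆ D` the red ones; for `r : Finset {j // j ∉ D}`,
`a(r) = K(r⁺ ∪ R)`, `b(r) = K((rᶜ)⁺ ∪ (D ∖ R))`.  Then for every monotone `g`: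
`0 ≤ Σ_r [∀ i ∈ D, ¬(far i ∈ a r ∧ far i ∈ b r)]·([u ∈ a r] − [u ∈ b r])·(g(a r) − g(b r))`. [cite: KozmaNitzan2024, Questions 8–9 (§5.5 p. 36) (context)] -/
theorem noCoreNbhd_class_nonneg (D R : Finset ι) (hRD : R ⊆ D) {u : V} (far : ι → V) (hfar : ∀ i ∈ D, ends i = s(u, far i)) (hfar_ne : ∀ i ∈ D, far i ≠ u)
    (g : Set V → ℝ) (hg : Monotone g) :
    0 ≤ ∑ r : Finset {j : ι // j ∉ D},
      (if (∀ i ∈ D, ¬ (far i ∈ openCluster (ends '' (↑(r.map (Function.Embedding.subtype _) ∪ R) : Set ι)) x ∧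
                        far i ∈ openCluster (ends '' (↑(rᶜ.map (Function.Embedding.subtype _) ∪ (D \ R)) : Set ι)) x)) then
        ((if u ∈ openCluster (ends '' (↑(r.map (Function.Embedding.subtype _) ∪ R) : Set ι)) x then (1 : ℝ) else 0) -
          (if u ∈ openCluster (ends '' (↑(rᶜ.map (Function.Embedding.subtype _) ∪ (D \ R)) : Set ι)) x then (1 : ℝ) else 0)) *
        (g (openCluster (ends '' (↑(r.map (Function.Embedding.subtype _) ∪ R) : Set ι)) x) -
          g (openCluster (ends '' (↑(rᶜ.map (Function.Embedding.subtype _) ∪ (D \ R)) : Set ι)) x))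
      else 0) := by
  set emb := Function.Embedding.subtype (fun j : ι => j ∉ D) with hemb
  set a : Finset {j : ι // j ∉ D} → Set V := fun r => openCluster (ends '' (↑(r.map emb ∪ R) : Set ι)) x with ha
  set a' : Finset {j : ι // j ∉ D} → Set V := fun r => openCluster (ends '' (↑(r.map emb ∪ (D \ R)) : Set ι)) x with ha'
  change 0 ≤ ∑ r : Finset {j : ι // j ∉ D}, (if (∀ i ∈ D, ¬ (far i ∈ a r ∧ far i ∈ a' rᶜ)) then
    ((if u ∈ a r then (1 : ℝ) else 0) - (if u ∈ a' rᶜ then (1 : ℝ) else 0)) * (g (a r) - g (a' rᶜ)) else 0)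
  -- monotonicity
  have hmono_union : ∀ {r t : Finset {j : ι // j ∉ D}} (X : Finset ι), r ⊆ t → r.map emb ∪ X ⊆ t.map emb ∪ X :=
    fun X hrt => Finset.union_subset_union (Finset.map_subset_map.mpr hrt) (le_refl X)
  have ha_mono : Monotone a := fun r t hrt => openCluster_image_mono ends (hmono_union R hrt) x
  have ha'_mono : Monotone a' := fun r t hrt => openCluster_image_mono ends (hmono_union (D \ R) hrt) x
  -- far ends follow `u`: red `D`-edges in `R` for `a`, blue ones in `D \ R` for `a'`
  have hfa : ∀ t, ∀ i ∈ R, (far i ∈ a t ↔ u ∈ a t) := fun t i hi =>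
    mem_openCluster_iff_of_edge ends x (t.map emb ∪ R) (y := far i) (p := u)
      (by rw [hfar i (hRD hi), Sym2.eq_swap]) (hfar_ne i (hRD hi)).symm (Finset.mem_union_right _ hi)
  have hfa' : ∀ t, ∀ i ∈ D \ R, (far i ∈ a' t ↔ u ∈ a' t) := fun t i hi =>
    mem_openCluster_iff_of_edge ends x (t.map emb ∪ (D \ R)) (y := far i) (p := u)
      (by rw [hfar i (Finset.mem_sdiff.mp hi).1, Sym2.eq_swap]) (hfar_ne i (Finset.mem_sdiff.mp hi).1).symm (Finset.mem_union_right _ hi)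
  -- inactive stars at `u`
  have hDR : ∀ i ∈ D \ R, u ∈ ends i := fun i hi => by rw [hfar i (Finset.mem_sdiff.mp hi).1]; exact Sym2.mem_mk_left _ _
  have hRu : ∀ i ∈ R, u ∈ ends i := fun i hi => by rw [hfar i (hRD hi)]; exact Sym2.mem_mk_left _ _
  have inact1 : ∀ t : Finset {j : ι // j ∉ D}, u ∉ a' t → a' t ⊆ a t := by
    intro t hu v hv
    have h1 := openCluster_union_star_subset ends x (t.map emb) (D \ R) hDR hu hv
    exact openCluster_image_mono ends Finset.subset_union_left x h1
  have inact2 : ∀ t : Finset {j : ι // j ∉ D}, u ∉ a t → a t ⊆ a' t := by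
    intro t hu v hv
    have h1 := openCluster_union_star_subset ends x (t.map emb) R hRu hu hv
    exact openCluster_image_mono ends Finset.subset_union_left x h1
  -- the event on the two supports
  have hevA : ∀ r, u ∈ a r → u ∉ a' rᶜ →
      ((∀ i ∈ D, ¬ (far i ∈ a r ∧ far i ∈ a' rᶜ)) ↔ (∀ i ∈ R, far i ∉ a' rᶜ)) := by
    intro r hu hu'
    constructor
    · intro h i hi hb
      exact h i (hRD hi) ⟨(hfa r i hi).mpr hu, hb⟩
    · intro h i hi hab
      by_cases hiR : i ∈ R
      · exact h i hiR hab.2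
      · have hi' : i ∈ D \ R := Finset.mem_sdiff.mpr ⟨hi, hiR⟩
        exact hu' ((hfa' rᶜ i hi').mp hab.2)
  have hevB : ∀ r, u ∉ a r → u ∈ a' rᶜ →
      ((∀ i ∈ D, ¬ (far i ∈ a r ∧ far i ∈ a' rᶜ)) ↔ (∀ i ∈ D \ R, far i ∉ a r)) := by
    intro r hu hu'
    constructor
    · intro h i hi hain
      exact h i (Finset.mem_sdiff.mp hi).1 ⟨hain, (hfa' rᶜ i hi).mpr hu'⟩
    · intro h i hi hab
      by_cases hiR : i ∈ R
      · exact hu ((hfa r i hiR).mp hab.1)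
      · exact h i (Finset.mem_sdiff.mpr ⟨hi, hiR⟩) hab.1
  -- the weights
  set E₁ : Finset {j : ι // j ∉ D} → ℝ := fun r => if (u ∈ a r ∧ u ∉ a' rᶜ ∧ ∀ i ∈ R, far i ∉ a' rᶜ) then (1 : ℝ) else 0 with hE₁
  set E₂ : Finset {j : ι // j ∉ D} → ℝ := fun r => if (u ∈ a' r ∧ u ∉ a rᶜ ∧ ∀ i ∈ D \ R, far i ∉ a rᶜ) then (1 : ℝ) else 0 with hE₂
  set N₂ : Finset {j : ι // j ∉ D} → ℝ := fun r => if (u ∉ a r ∧ u ∈ a' rᶜ ∧ ∀ i ∈ D \ R, far i ∉ a r) then (1 : ℝ) else 0 with hN₂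
  -- pointwise: summand = E₁·(g a − g b) − N₂·(g a − g b)
  have hpt : ∀ r : Finset {j : ι // j ∉ D}, (if (∀ i ∈ D, ¬ (far i ∈ a r ∧ far i ∈ a' rᶜ)) then
      ((if u ∈ a r then (1 : ℝ) else 0) - (if u ∈ a' rᶜ then (1 : ℝ) else 0)) * (g (a r) - g (a' rᶜ)) else 0) =
      E₁ r * (g (a r) - g (a' rᶜ)) - N₂ r * (g (a r) - g (a' rᶜ)) := by
    intro r
    simp only [hE₁, hN₂]
    by_cases h1 : u ∈ a r <;> by_cases h2 : u ∈ a' rᶜ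
    · simp [h1, h2]
    · have e := hevA r h1 h2
      by_cases h3 : ∀ i ∈ R, far i ∉ a' rᶜ
      · have hc : ∀ i ∈ D, ¬ (far i ∈ a r ∧ far i ∈ a' rᶜ) := e.mpr h3
        have hp : (u ∈ a r ∧ u ∉ a' rᶜ ∧ ∀ i ∈ R, far i ∉ a' rᶜ) := ⟨h1, h2, h3⟩
        have hn : ¬ (u ∉ a r ∧ u ∈ a' rᶜ ∧ ∀ i ∈ D \ R, far i ∉ a r) := fun h => h.1 h1
        rw [if_pos hc, if_pos h1, if_neg h2, if_pos hp, if_neg hn]; ring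
      · have hc : ¬ ∀ i ∈ D, ¬ (far i ∈ a r ∧ far i ∈ a' rᶜ) := fun h => h3 (e.mp h)
        rw [if_neg hc]
        have hn1 : ¬ (u ∈ a r ∧ u ∉ a' rᶜ ∧ ∀ i ∈ R, far i ∉ a' rᶜ) := fun h => h3 h.2.2
        have hn : ¬ (u ∉ a r ∧ u ∈ a' rᶜ ∧ ∀ i ∈ D \ R, far i ∉ a r) := fun h => h.1 h1
        rw [if_neg hn1, if_neg hn]; ring
    · have e := hevB r h1 h2
      have hn1 : ¬ (u ∈ a r ∧ u ∉ a' rᶜ ∧ ∀ i ∈ R, far i ∉ a' rᶜ) := fun h => h1 h.1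
      by_cases h3 : ∀ i ∈ D \ R, far i ∉ a r
      · have hc : ∀ i ∈ D, ¬ (far i ∈ a r ∧ far i ∈ a' rᶜ) := e.mpr h3
        have hp : (u ∉ a r ∧ u ∈ a' rᶜ ∧ ∀ i ∈ D \ R, far i ∉ a r) := ⟨h1, h2, h3⟩
        rw [if_pos hc, if_neg h1, if_pos h2, if_neg hn1, if_pos hp]; ring
      · have hc : ¬ ∀ i ∈ D, ¬ (far i ∈ a r ∧ far i ∈ a' rᶜ) := fun h => h3 (e.mp h)
        have hn : ¬ (u ∉ a r ∧ u ∈ a' rᶜ ∧ ∀ i ∈ D \ R, far i ∉ a r) := fun h => h3 h.2.2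
        rw [if_neg hc, if_neg hn1, if_neg hn]; ring
    · simp [h1, h2]
  rw [Finset.sum_congr rfl (fun r _ => hpt r), Finset.sum_sub_distrib]
  -- fold the N₂ part through the swap
  have hswap : ∑ r : Finset {j : ι // j ∉ D}, N₂ r * (g (a r) - g (a' rᶜ)) = - ∑ r : Finset {j : ι // j ∉ D}, E₂ r * (g (a' r) - g (a rᶜ)) := by
    rw [← Fintype.sum_equiv (Equiv.mk (fun r : Finset {j : ι // j ∉ D} => rᶜ) (fun r => rᶜ) (fun r => compl_compl r) (fun r => compl_compl r))
      (fun r => N₂ rᶜ * (g (a rᶜ) - g (a' rᶜᶜ))) (fun r => N₂ r * (g (a r) - g (a' rᶜ))) (fun r => by simp only [Equiv.coe_fn_mk]),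
      ← Finset.sum_neg_distrib]
    refine Finset.sum_congr rfl fun r _ => ?_
    have hNE : N₂ rᶜ = E₂ r := by
      simp only [hN₂, hE₂, compl_compl]
      by_cases h : (u ∉ a rᶜ ∧ u ∈ a' r ∧ ∀ i ∈ D \ R, far i ∉ a rᶜ)
      · rw [if_pos h, if_pos ⟨h.2.1, h.1, h.2.2⟩]
      · have h' : ¬ (u ∈ a' r ∧ u ∉ a rᶜ ∧ ∀ i ∈ D \ R, far i ∉ a rᶜ) := fun hh => h ⟨hh.2.1, hh.1, hh.2.2⟩
        rw [if_neg h, if_neg h']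
    rw [hNE, compl_compl]; ring
  rw [hswap, sub_neg_eq_add]
  -- monotone weights
  have hE₁_mono : Monotone E₁ := by
    intro r t hrt
    simp only [hE₁]
    by_cases hr : u ∈ a r ∧ u ∉ a' rᶜ ∧ ∀ i ∈ R, far i ∉ a' rᶜ
    · have hc : a' tᶜ ⊆ a' rᶜ := ha'_mono (compl_subset_compl.mpr hrt)
      have ht : u ∈ a t ∧ u ∉ a' tᶜ ∧ ∀ i ∈ R, far i ∉ a' tᶜ :=
        ⟨ha_mono hrt hr.1, fun h => hr.2.1 (hc h), fun i hi h => hr.2.2 i hi (hc h)⟩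
      rw [if_pos hr, if_pos ht]
    · rw [if_neg hr]; split_ifs <;> norm_num
  have hE₂_mono : Monotone E₂ := by
    intro r t hrt
    simp only [hE₂]
    by_cases hr : u ∈ a' r ∧ u ∉ a rᶜ ∧ ∀ i ∈ D \ R, far i ∉ a rᶜ
    · have hc : a tᶜ ⊆ a rᶜ := ha_mono (compl_subset_compl.mpr hrt)
      have ht : u ∈ a' t ∧ u ∉ a tᶜ ∧ ∀ i ∈ D \ R, far i ∉ a tᶜ :=
        ⟨ha'_mono hrt hr.1, fun h => hr.2.1 (hc h), fun i hi h => hr.2.2 i hi (hc h)⟩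
      rw [if_pos hr, if_pos ht]
    · rw [if_neg hr]; split_ifs <;> norm_num
  -- the four brackets
  have hB1 : 0 ≤ ∑ r : Finset {j : ι // j ∉ D}, E₁ r * (g (a r) - g (a rᶜ)) :=
    AntitheticProduct.sum_mul_sub_compl_nonneg E₁ (fun r => g (a r)) hE₁_mono (fun r t hrt => hg (ha_mono hrt))
  have hB2 : 0 ≤ ∑ r : Finset {j : ι // j ∉ D}, E₁ r * (g (a rᶜ) - g (a' rᶜ)) := by
    refine Finset.sum_nonneg fun r _ => ?_
    simp only [hE₁]
    split_ifs with h
    · have hsub : a' rᶜ ⊆ a rᶜ := inact1 rᶜ h.2.1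
      have := hg hsub
      linarith
    · simp
  have hB3 : 0 ≤ ∑ r : Finset {j : ι // j ∉ D}, E₂ r * (g (a' r) - g (a' rᶜ)) :=
    AntitheticProduct.sum_mul_sub_compl_nonneg E₂ (fun r => g (a' r)) hE₂_mono (fun r t hrt => hg (ha'_mono hrt))
  have hB4 : 0 ≤ ∑ r : Finset {j : ι // j ∉ D}, E₂ r * (g (a' rᶜ) - g (a rᶜ)) := by
    refine Finset.sum_nonneg fun r _ => ?_
    simp only [hE₂]
    split_ifs with h
    · have hsub : a rᶜ ⊆ a' rᶜ := inact2 rᶜ h.2.1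
      have := hg hsub
      linarith
    · simp
  have hsplit1 : ∑ r : Finset {j : ι // j ∉ D}, E₁ r * (g (a r) - g (a' rᶜ)) =
      ∑ r : Finset {j : ι // j ∉ D}, E₁ r * (g (a r) - g (a rᶜ)) + ∑ r : Finset {j : ι // j ∉ D}, E₁ r * (g (a rᶜ) - g (a' rᶜ)) := by
    rw [← Finset.sum_add_distrib]; refine Finset.sum_congr rfl fun r _ => ?_; ring
  have hsplit2 : ∑ r : Finset {j : ι // j ∉ D}, E₂ r * (g (a' r) - g (a rᶜ)) =
      ∑ r : Finset {j : ι // j ∉ D}, E₂ r * (g (a' r) - g (a' rᶜ)) + ∑ r : Finset {j : ι // j ∉ D}, E₂ r * (g (a' rᶜ) - g (a rᶜ)) := by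
    rw [← Finset.sum_add_distrib]; refine Finset.sum_congr rfl fun r _ => ?_; ring
  rw [hsplit1, hsplit2]
  linarith

/-- **The cube splits along a fixed edge set.**  For any `D : Finset ι` and `F`:
`Σ_{s : Finset ι} F(s, sᶜ) = Σ_{R ⊆ D} Σ_{r : Finset {j // j ∉ D}} F(r⁺ ∪ R, (rᶜ)⁺ ∪ (D ∖ R))` (`r⁺ = r.map val`).  [cite: KozmaNitzan2024, §5.5 (context only; bookkeeping)] -/
theorem sum_cube_eq_sum_powerset_subcube (D : Finset ι) (F : Finset ι → Finset ι → ℝ) :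
    ∑ s : Finset ι, F s sᶜ =
    ∑ R ∈ D.powerset, ∑ r : Finset {j : ι // j ∉ D},
      F (r.map (Function.Embedding.subtype _) ∪ R) (rᶜ.map (Function.Embedding.subtype _) ∪ (D \ R)) := by
  classical
  set Pr : ι → Prop := fun j => j ∉ D with hPr
  set emb := Function.Embedding.subtype Pr with hemb
  -- group the colourings by their trace on D
  rw [← Finset.sum_fiberwise_of_maps_to (s := (univ : Finset (Finset ι))) (t := D.powerset) (g := fun s => s ∩ D)
    (fun s _ => Finset.mem_powerset.mpr Finset.inter_subset_right)]
  refine Finset.sum_congr rfl fun R hR => ?_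
  have hRD : R ⊆ D := Finset.mem_powerset.mp hR
  -- facts about the embedding
  have mem_emb : ∀ (t : Finset {j : ι // Pr j}) (c : ι), c ∈ t.map emb ↔ ∃ h : Pr c, (⟨c, h⟩ : {j : ι // Pr j}) ∈ t :=
    fun t c => mem_map_subtype_iff Pr t c
  have hcompl : ∀ r : Finset {j : ι // Pr j}, (r.map emb ∪ R)ᶜ = rᶜ.map emb ∪ (D \ R) := by
    intro r; ext c
    rw [Finset.mem_compl, Finset.mem_union, Finset.mem_union, Finset.mem_sdiff, mem_emb, mem_emb]
    by_cases hcD : c ∈ D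
    · have hnP : ¬ Pr c := fun h => h hcD
      constructor
      · intro h; exact Or.inr ⟨hcD, fun hcR => h (Or.inr hcR)⟩
      · rintro (⟨hP, _⟩ | ⟨_, hcR⟩)
        · exact absurd hP hnP
        · rintro (⟨hP, _⟩ | hcR'); exact hnP hP; exact hcR hcR'
    · have hP : Pr c := hcD
      constructor
      · intro h
        refine Or.inl ⟨hP, Finset.mem_compl.mpr fun hr => h (Or.inl ⟨hP, hr⟩)⟩
      · rintro (⟨hP', hrc⟩ | ⟨hcD', _⟩)
        · rintro (⟨hP'', hr⟩ | hcR)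
          · exact (Finset.mem_compl.mp hrc) hr
          · exact hcD (hRD hcR)
        · exact absurd hcD' hcD
  have hleft : ∀ s ∈ univ.filter (fun s : Finset ι => s ∩ D = R), (s.subtype Pr).map emb ∪ R = s := by
    intro s hs
    have hsD : s ∩ D = R := (Finset.mem_filter.mp hs).2
    rw [hemb, Finset.subtype_map]
    ext c
    simp only [Finset.mem_union, Finset.mem_filter, hPr]
    constructor
    · rintro (⟨hc, _⟩ | hcR)
      · exact hc
      · have : c ∈ s ∩ D := by rw [hsD]; exact hcR
        exact (Finset.mem_inter.mp this).1
    · intro hc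
      by_cases hcD : c ∈ D
      · right; rw [← hsD]; exact Finset.mem_inter.mpr ⟨hc, hcD⟩
      · exact Or.inl ⟨hc, hcD⟩
  refine Finset.sum_nbij' (fun s => s.subtype Pr) (fun r => r.map emb ∪ R) ?_ ?_ hleft ?_ ?_
  · intro s _; exact Finset.mem_univ _
  · intro r _
    refine Finset.mem_filter.mpr ⟨Finset.mem_univ _, ?_⟩
    ext c
    rw [Finset.mem_inter, Finset.mem_union, mem_emb]
    constructor
    · rintro ⟨(⟨hP, _⟩ | hcR), hcD⟩
      · exact absurd hcD hP
      · exact hcR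
    · intro hcR; exact ⟨Or.inr hcR, hRD hcR⟩
  · intro r _
    ext c
    rw [Finset.mem_subtype, Finset.mem_union, mem_emb]
    constructor
    · rintro (⟨_, h⟩ | hcR)
      · exact h
      · exact absurd (hRD hcR) c.2
    · intro h; exact Or.inl ⟨c.2, h⟩
  · intro s hs
    rw [← hcompl, hleft s hs]

open Classical in
/-- **THEOREM: the no-core box at the neighbourhood of the point is nonnegative.**  Let `D` be any finite set of edges at `u`, with far ends `far i` (`ends i = s(u, far i)`, `far i ≠ u`).
Then for `f = 1[u ∈ ·]` and every monotone `g`:  `0 ≤ Σ_{s : ∀ i ∈ D, ¬(far i ∈ K s ∧ far i ∈ K sᶜ)} ([u ∈ K s] − [u ∈ K sᶜ])·(g(K s) − g(K sᶜ))` — prim-lf-2 gen 46's NO-CORE(D′) =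
B(∅, D′) ≥ 0 for every vertex set `D′ ⊆ N(u)` (take one edge `u d` per `d ∈ D′`), on every finite multigraph.  (`sum_cube_eq_sum_powerset_subcube` + `noCoreNbhd_class_nonneg` class by class.)
[cite: KozmaNitzan2024, Questions 8–9 (§5.5 p. 36) (context)] -/
theorem noCore_nbhd_nonneg (D : Finset ι) {u : V} (far : ι → V) (hfar : ∀ i ∈ D, ends i = s(u, far i)) (hfar_ne : ∀ i ∈ D, far i ≠ u)
    (g : Set V → ℝ) (hg : Monotone g) :
    0 ≤ ∑ s ∈ univ.filter (fun s : Finset ι => ∀ i ∈ D,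
        ¬ (far i ∈ openCluster (ends '' (↑s : Set ι)) x ∧ far i ∈ openCluster (ends '' (↑(sᶜ) : Set ι)) x)),
      ((if u ∈ openCluster (ends '' (↑s : Set ι)) x then (1 : ℝ) else 0) - (if u ∈ openCluster (ends '' (↑(sᶜ) : Set ι)) x then (1 : ℝ) else 0)) *
        (g (openCluster (ends '' (↑s : Set ι)) x) - g (openCluster (ends '' (↑(sᶜ) : Set ι)) x)) := by
  rw [Finset.sum_filter]
  rw [sum_cube_eq_sum_powerset_subcube D (fun s t => if (∀ i ∈ D, ¬ (far i ∈ openCluster (ends '' (↑s : Set ι)) x ∧ far i ∈ openCluster (ends '' (↑t : Set ι)) x)) then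
      ((if u ∈ openCluster (ends '' (↑s : Set ι)) x then (1 : ℝ) else 0) - (if u ∈ openCluster (ends '' (↑t : Set ι)) x then (1 : ℝ) else 0)) *
        (g (openCluster (ends '' (↑s : Set ι)) x) - g (openCluster (ends '' (↑t : Set ι)) x)) else 0)]
  refine Finset.sum_nonneg fun R hR => ?_
  exact noCoreNbhd_class_nonneg ends x D R (Finset.mem_powerset.mp hR) far hfar hfar_ne g hg

end Coefficientwise

end Summit.CriticalPhenomena.PercolationContinuityZ3.Theorems
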